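import Summits.Langlands.Langlands.Theses.RamifiedCoefficientSeed
import Summits.Langlands.Langlands.Theorems.DyadicOddResidueOddPrimesRegularFM
import Literature.NumberTheory.GaloisRepresentations.OddAbsolutelyIrreducibleProofs
import Literature.FieldTheory.AlgClosed.PadicAlgClEquivComplex
import Literature.NumberTheory.Automorphic.GLnAdelicStructureProofs
import HarnessLib

/-!
# `AdjointLiftingGL3` (crux stmt-Langlands-16779, route `RamifiedCoefficientSeed`): the seed
# hypotheses admit the EISENSTEIN representation `1 ⊕ ε⁻¹ ⊕ ε⁻²` — residual irreducibility is
# load-bearing (negative-side support, refuter cdisprove seat; sorry-free)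

The crux `Summit.Langlands.Langlands.Theses.RamifiedCoefficientSeed.AdjointLiftingGL3` lifts
automorphy to `ρ : Γ_ℚ →ₜ* GL₃(ℚ̄_p)` (`p ≥ 11`, unramified a.e., crystalline with labelled HT weights
`{0,1,2}`, `ρ̄|_{ℚ(ζ_p)}` absolutely irreducible) from the ADJOINT SEED
`‖tr ρ(σ) - η(σ)(tr ρ₀(σ)²/det ρ₀(σ) - 1)‖ < 1` (`ρ₀` odd).  This file certifies which of these
hypotheses the seed does NOT subsume:

* `seed_exact`, `seed_norm_lt_one` — the reducible `ρ_Eis = 1 ⊕ ε⁻¹ ⊕ ε⁻²` satisfies the seed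
  congruence EXACTLY with the ODD `ρ₀ = 1 ⊕ ε⁻¹` (`rho0_isOdd`: `det ρ₀(c) = ε(c)⁻¹ = -1`) and
  `η = ε⁻¹` (the identity `1 + a + a² = a((1+a)²/a - 1)`, i.e. `ρ_Eis = ε⁻¹ ⊗ ad(1 ⊕ ε⁻¹)⁰`);
* `rhoEis_unramified_ae` — `ρ_Eis` is unramified at every `v ∤ p`;
* `rhoEis_not_isIrreducible` — `ρ_Eis` is reducible;
* `seedHypotheses_admit_eisenstein` — packaging: seed + oddness + "unramified a.e." hold for a
  REDUCIBLE `ρ`, so none of "`ρ̄₀` irreducible", "`ad⁰ρ̄₀` irreducible", "`ρ̄` non-Eisenstein" is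
  carried by the seed; every such use in a proof of the crux must be derived from
  `IsResiduallyAbsIrreducible (ρ.restrictField (CyclotomicField p ℚ))`;
* `adjointLiftingGL3_false_without_residualIrreducibility` — the crux with that hypothesis DELETED
  (written inline, verbatim otherwise; no proposition is defined under `Summits/`) is FALSE at any
  prime `p ≥ 11` for which (i) the pinned Fontaine datum declares `ρ_Eis` crystalline with labelled
  weights `{0,1,2}` (true for `(B_dR, WD ∘ D_pst)`: `ℚ_p(m)` is crystalline, `HT(ε^m) = {-m}`,
  `D_cris` additive — Fontaine 1994 Exp. VIII §2.3.7, clause (F11) of `IsFontaineDatum`; not a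
  consequence of clauses (F1)–(F12), hence a hypothesis) and (ii) no `L`-algebraic cuspidal `π` of
  `GL₃(𝔸_ℚ)` is Satake–Frobenius compatible a.e. with `ρ_Eis` (Jacquet–Shalika (5.1.3): a match
  forces Satake parameters `{1, q, q²}`, of modulus `q > q^{1/2}` after any unitary twist; the tree's
  fact `norm_satakeParameter_le_sqrt` is stated for the `L²` avatars, the bridge to
  `CuspidalAutomorphicRepData` being unproved, hence a hypothesis): `ι : ℚ̄_p ≃ ℂ` exists
  (`PadicAlgCl.nonempty_ringEquiv_complex`), `hcpt` holds (`isCompact_glFiniteIntegralLevel_holds`),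
  and the weakened crux would make `ρ_Eis` cuspidal automorphic.

This file does NOT refute the crux (which is Fontaine–Mazur-predicted); it records that residual
absolute irreducibility is the load-bearing hypothesis separating it from a false statement, and
provides the rank-`n` diagonal framed representation `diagRep` (`χ₁ ⊕ ⋯ ⊕ χₙ`) for reuse.
-/

noncomputable section

open scoped MatrixGroups NumberField
open NumberField IsDedekindDomain Filter Field
open Literature.NumberTheory.GaloisRepresentations Literature.NumberTheory.Automorphic

namespace Summit.Langlands.Langlands.Theorems.AdjointLiftingGL3.Negative

set_option linter.dupNamespace false -- project-wide option; `Summit.Langlands.Langlands` is the mandated namespace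

/-! ### Diagonal framed representations `χ₁ ⊕ ⋯ ⊕ χₙ` -/

section Diagonal

variable {G : Type*} [Group G] [TopologicalSpace G] {A : Type*} [CommRing A] [TopologicalSpace A]
  {n : ℕ}

/-- The diagonal entries `g ↦ (χᵢ g)ᵢ` of a family of continuous characters. [folklore] -/
def diagEntries (χ : Fin n → (G →ₜ* Aˣ)) (g : G) : Fin n → A := fun i => ((χ i g : Aˣ) : A)

/-- Unfolding lemma for `diagEntries`. [folklore] -/
@[simp] lemma diagEntries_apply (χ : Fin n → (G →ₜ* Aˣ)) (g : G) (i : Fin n) :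
    diagEntries χ g i = ((χ i g : Aˣ) : A) := rfl

/-- `diagEntries χ 1 = 1`. [folklore] -/
lemma diagEntries_one (χ : Fin n → (G →ₜ* Aˣ)) : diagEntries χ 1 = 1 := by
  ext i; simp [diagEntries]

/-- `diagEntries χ` is multiplicative. [folklore] -/
lemma diagEntries_mul (χ : Fin n → (G →ₜ* Aˣ)) (g h : G) :
    diagEntries χ (g * h) = diagEntries χ g * diagEntries χ h := by
  ext i; simp [diagEntries]

/-- `diagEntries χ` is continuous (each `χᵢ` is). [folklore] -/
lemma continuous_diagEntries (χ : Fin n → (G →ₜ* Aˣ)) : Continuous (diagEntries χ) :=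
  continuous_pi fun i => Units.continuous_val.comp (map_continuous (χ i))

/-- `diag(χ₁ g, …, χₙ g) ∈ GL_n(A)`. [folklore] -/
def diagGL (χ : Fin n → (G →ₜ* Aˣ)) (g : G) : GL (Fin n) A where
  val := Matrix.diagonal (diagEntries χ g)
  inv := Matrix.diagonal (diagEntries χ g⁻¹)
  val_inv := by
    rw [Matrix.diagonal_mul_diagonal, ← Pi.mul_def, ← diagEntries_mul, mul_inv_cancel,
      diagEntries_one]
    exact Matrix.diagonal_one
  inv_val := by
    rw [Matrix.diagonal_mul_diagonal, ← Pi.mul_def, ← diagEntries_mul, inv_mul_cancel,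
      diagEntries_one]
    exact Matrix.diagonal_one

variable [IsTopologicalGroup G]

/-- **The direct sum `χ₁ ⊕ ⋯ ⊕ χₙ` of continuous characters as a framed representation**
`g ↦ diag(χ₁ g, …, χₙ g)`, a continuous homomorphism `G →ₜ* GL_n(A)` (rank-`n` version of the
tree's `FramedRep.exists_diagonal_two`). [folklore] -/
def diagRep (χ : Fin n → (G →ₜ* Aˣ)) : FramedRep G A n where
  toFun := diagGL χ
  map_one' := Units.ext (by simp [diagGL, diagEntries_one])
  map_mul' g h := Units.ext (by
    change Matrix.diagonal (diagEntries χ (g * h)) =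
      Matrix.diagonal (diagEntries χ g) * Matrix.diagonal (diagEntries χ h)
    rw [Matrix.diagonal_mul_diagonal, diagEntries_mul]
    rfl)
  continuous_toFun := by
    refine Units.continuous_iff.2 ⟨(continuous_diagEntries χ).matrix_diagonal, ?_⟩
    change Continuous fun g => Matrix.diagonal (diagEntries χ g⁻¹)
    exact ((continuous_diagEntries χ).comp continuous_inv).matrix_diagonal

/-- The matrix of `diagRep χ g` is `diag(χᵢ g)`. [folklore] -/
@[simp] lemma diagRep_apply_coe (χ : Fin n → (G →ₜ* Aˣ)) (g : G) :
    ((diagRep χ g : GL (Fin n) A) : Matrix (Fin n) (Fin n) A) = Matrix.diagonal (diagEntries χ g) :=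
  rfl

/-- `tr diag(χᵢ g) = Σᵢ χᵢ g` (Mathlib `Matrix.trace_diagonal`). [folklore] -/
lemma trace_diagRep (χ : Fin n → (G →ₜ* Aˣ)) (g : G) :
    ((diagRep χ g : GL (Fin n) A) : Matrix (Fin n) (Fin n) A).trace = ∑ i, ((χ i g : Aˣ) : A) := by
  rw [diagRep_apply_coe, Matrix.trace_diagonal]
  rfl

/-- `det diag(χᵢ g) = ∏ᵢ χᵢ g` (Mathlib `Matrix.det_diagonal`). [folklore] -/
lemma det_diagRep (χ : Fin n → (G →ₜ* Aˣ)) (g : G) :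
    ((diagRep χ g : GL (Fin n) A) : Matrix (Fin n) (Fin n) A).det = ∏ i, ((χ i g : Aˣ) : A) := by
  rw [diagRep_apply_coe, Matrix.det_diagonal]
  rfl

end Diagonal

/-! ### The Eisenstein witness `ρ_Eis = 1 ⊕ ε⁻¹ ⊕ ε⁻²`, `ρ₀ = 1 ⊕ ε⁻¹`, `η = ε⁻¹` -/

section Witness

variable (p : ℕ) [Fact p.Prime]

/-- The power `ε^m` (`m ∈ ℤ`) of the `p`-adic cyclotomic character, `ℚ̄_p`-valued. [folklore] -/
def epsPow (m : ℤ) : absoluteGaloisGroup ℚ →ₜ* (PadicAlgCl p)ˣ where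
  toFun σ := cyclotomicPadicAlgCl ℚ p σ ^ m
  map_one' := by simp
  map_mul' σ τ := by rw [map_mul, mul_zpow]
  continuous_toFun := (cyclotomicPadicAlgCl ℚ p).continuous.zpow m

/-- Unfolding lemma for `epsPow`. [folklore] -/
@[simp] lemma epsPow_apply (m : ℤ) (σ : absoluteGaloisGroup ℚ) :
    epsPow p m σ = cyclotomicPadicAlgCl ℚ p σ ^ m := rfl

/-- `ε^m` in `ℚ̄_p`: `↑(ε(σ)^m) = (↑ε(σ))^m`. [folklore] -/
lemma coe_epsPow (m : ℤ) (σ : absoluteGaloisGroup ℚ) :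
    ((epsPow p m σ : (PadicAlgCl p)ˣ) : PadicAlgCl p) =
      ((cyclotomicPadicAlgCl ℚ p σ : (PadicAlgCl p)ˣ) : PadicAlgCl p) ^ m := by
  rw [epsPow_apply, Units.val_zpow_eq_zpow_val]

/-- `ρ_Eis = 1 ⊕ ε⁻¹ ⊕ ε⁻²` (the `p`-adic realisation of the Eisenstein class `1 ⊞ |·| ⊞ |·|²`). [folklore] -/
def rhoEis : FramedGaloisRep ℚ (PadicAlgCl p) 3 := diagRep ![epsPow p 0, epsPow p (-1), epsPow p (-2)]

/-- `ρ₀ = 1 ⊕ ε⁻¹` (odd, reducible). [folklore] -/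
def rho0 : FramedGaloisRep ℚ (PadicAlgCl p) 2 := diagRep ![epsPow p 0, epsPow p (-1)]

/-- `η = ε⁻¹`. [folklore] -/
def eta : FramedGaloisRep ℚ (PadicAlgCl p) 1 := diagRep ![epsPow p (-1)]

variable {p}

/-- `ε(σ) ≠ 0` in `ℚ̄_p`. [folklore] -/
lemma e_ne_zero (σ : absoluteGaloisGroup ℚ) : ((cyclotomicPadicAlgCl ℚ p σ : (PadicAlgCl p)ˣ) : PadicAlgCl p) ≠ 0 := Units.ne_zero _

/-- `tr ρ_Eis(σ) = 1 + ε(σ)⁻¹ + ε(σ)⁻²`. [folklore] -/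
lemma trace_rhoEis (σ : absoluteGaloisGroup ℚ) :
    ((rhoEis p σ : GL (Fin 3) (PadicAlgCl p)) : Matrix (Fin 3) (Fin 3) (PadicAlgCl p)).trace =
      1 + ((cyclotomicPadicAlgCl ℚ p σ : (PadicAlgCl p)ˣ) : PadicAlgCl p)⁻¹ + (((cyclotomicPadicAlgCl ℚ p σ : (PadicAlgCl p)ˣ) : PadicAlgCl p)⁻¹) ^ 2 := by
  rw [rhoEis, trace_diagRep, Fin.sum_univ_three]
  simp only [Matrix.cons_val_zero, Matrix.cons_val_one, Matrix.cons_val, coe_epsPow, zpow_zero,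
    zpow_neg, zpow_one]
  rw [show ((2 : ℤ)) = ((2 : ℕ) : ℤ) from rfl, zpow_natCast, inv_pow]

/-- `tr ρ₀(σ) = 1 + ε(σ)⁻¹`. [folklore] -/
lemma trace_rho0 (σ : absoluteGaloisGroup ℚ) :
    ((rho0 p σ : GL (Fin 2) (PadicAlgCl p)) : Matrix (Fin 2) (Fin 2) (PadicAlgCl p)).trace =
      1 + ((cyclotomicPadicAlgCl ℚ p σ : (PadicAlgCl p)ˣ) : PadicAlgCl p)⁻¹ := by
  rw [rho0, trace_diagRep, Fin.sum_univ_two]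
  simp only [Matrix.cons_val_zero, Matrix.cons_val_one, coe_epsPow, zpow_zero, zpow_neg, zpow_one]

/-- `det ρ₀(σ) = ε(σ)⁻¹`. [folklore] -/
lemma det_rho0 (σ : absoluteGaloisGroup ℚ) :
    ((rho0 p σ : GL (Fin 2) (PadicAlgCl p)) : Matrix (Fin 2) (Fin 2) (PadicAlgCl p)).det =
      ((cyclotomicPadicAlgCl ℚ p σ : (PadicAlgCl p)ˣ) : PadicAlgCl p)⁻¹ := by
  rw [rho0, det_diagRep, Fin.prod_univ_two]
  simp only [Matrix.cons_val_zero, Matrix.cons_val_one, coe_epsPow, zpow_zero, zpow_neg, zpow_one,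
    one_mul]

/-- `η(σ) = ε(σ)⁻¹` (the single entry). [folklore] -/
lemma eta_entry (σ : absoluteGaloisGroup ℚ) :
    ((eta p σ : GL (Fin 1) (PadicAlgCl p)) : Matrix (Fin 1) (Fin 1) (PadicAlgCl p)) 0 0 = ((cyclotomicPadicAlgCl ℚ p σ : (PadicAlgCl p)ˣ) : PadicAlgCl p)⁻¹ := by
  rw [eta, diagRep_apply_coe, Matrix.diagonal_apply_eq]
  simp only [diagEntries_apply, Matrix.cons_val_fin_one, coe_epsPow, zpow_neg, zpow_one]

/-- **The seed congruence holds EXACTLY for the Eisenstein triple**: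
`tr ρ_Eis(σ) = η(σ) · (tr ρ₀(σ)² / det ρ₀(σ) - 1)` for every `σ` (the identity
`1 + a + a² = a ((1 + a)²/a - 1)`, `a = ε(σ)⁻¹`; i.e. `1 ⊕ ε⁻¹ ⊕ ε⁻² = ε⁻¹ ⊗ ad⁰(1 ⊕ ε⁻¹)`). [folklore] -/
theorem seed_exact (σ : absoluteGaloisGroup ℚ) :
    ((rhoEis p σ : GL (Fin 3) (PadicAlgCl p)) : Matrix (Fin 3) (Fin 3) (PadicAlgCl p)).trace =
      ((eta p σ : GL (Fin 1) (PadicAlgCl p)) : Matrix (Fin 1) (Fin 1) (PadicAlgCl p)) 0 0 *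
        (((rho0 p σ : GL (Fin 2) (PadicAlgCl p)) : Matrix (Fin 2) (Fin 2) (PadicAlgCl p)).trace ^ 2 *
            (((rho0 p σ : GL (Fin 2) (PadicAlgCl p)) : Matrix (Fin 2) (Fin 2) (PadicAlgCl p)).det)⁻¹ -
          1) := by
  rw [trace_rhoEis, trace_rho0, det_rho0, eta_entry]
  have h := e_ne_zero (p := p) σ
  field_simp
  ring

/-- The seed hypothesis of the crux (`‖·‖ < 1` form) for the Eisenstein triple. [folklore] -/
theorem seed_norm_lt_one (σ : absoluteGaloisGroup ℚ) :
    ‖((rhoEis p σ : GL (Fin 3) (PadicAlgCl p)) : Matrix (Fin 3) (Fin 3) (PadicAlgCl p)).trace -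
        ((eta p σ : GL (Fin 1) (PadicAlgCl p)) : Matrix (Fin 1) (Fin 1) (PadicAlgCl p)) 0 0 *
          (((rho0 p σ : GL (Fin 2) (PadicAlgCl p)) : Matrix (Fin 2) (Fin 2) (PadicAlgCl p)).trace ^ 2 *
              (((rho0 p σ : GL (Fin 2) (PadicAlgCl p)) : Matrix (Fin 2) (Fin 2) (PadicAlgCl p)).det)⁻¹ -
            1)‖ < 1 := by
  rw [seed_exact σ, sub_self, norm_zero]
  exact zero_lt_one

/-- `ε(c) = -1` in `ℚ̄_p` for a complex conjugation `c`
(tree: `GaloisRep.cyclotomicCharacter_of_isComplexConjugation`). [folklore] -/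
lemma e_complexConjugation {φ : ℚ →+* ℝ} {c : absoluteGaloisGroup ℚ}
    (hc : IsComplexConjugation φ c) : ((cyclotomicPadicAlgCl ℚ p c : (PadicAlgCl p)ˣ) : PadicAlgCl p) = -1 := by
  rw [coe_cyclotomicPadicAlgCl_apply, GaloisRep.cyclotomicCharacter_of_isComplexConjugation p hc]
  simp

/-- **`ρ₀ = 1 ⊕ ε⁻¹` is odd**: `det ρ₀(c) = ε(c)⁻¹ = -1`. [folklore] -/
theorem rho0_isOdd : (rho0 p).IsOdd := by
  intro φ c hc
  refine Units.ext ?_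
  rw [Matrix.GeneralLinearGroup.val_det_apply, det_rho0, e_complexConjugation hc]
  simp

open Summit.Langlands.Langlands.Theorems in
/-- **`ρ_Eis` is unramified at every `v ∤ p`** (the cyclotomic character is). [folklore] -/
theorem rhoEis_isUnramifiedAt {v : HeightOneSpectrum (𝓞 ℚ)} (hv : (p : 𝓞 ℚ) ∉ v.asIdeal) :
    (rhoEis p).IsUnramifiedAt v := by
  intro 𝔓 h𝔓 σ hσ
  have h1 : cyclotomicPadicAlgCl ℚ p σ = 1 := cyclotomicPadicAlgCl_eq_one_of_mem_inertia p hv h𝔓 hσ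
  refine Units.ext ?_
  rw [rhoEis, diagRep_apply_coe, Units.val_one, ← Matrix.diagonal_one]
  congr 1
  ext i
  fin_cases i <;> simp [diagEntries, h1]

/-- **`ρ_Eis` is unramified almost everywhere** (away from the finitely many `v ∣ p`). [folklore] -/
theorem rhoEis_unramified_ae :
    ∀ᶠ v : HeightOneSpectrum (𝓞 ℚ) in cofinite, (rhoEis p).IsUnramifiedAt v := by
  have hp0 : (Ideal.span {(p : 𝓞 ℚ)} : Ideal (𝓞 ℚ)) ≠ ⊥ := by
    rw [Ne, Ideal.span_singleton_eq_bot]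
    exact_mod_cast (Fact.out : p.Prime).ne_zero
  refine Filter.eventually_cofinite.2
    ((Ideal.finite_factors (I := Ideal.span {(p : 𝓞 ℚ)}) (by rwa [Ne, Ideal.zero_eq_bot])).subset
      fun v hv => ?_)
  by_contra h
  exact hv (rhoEis_isUnramifiedAt fun hmem => h (Ideal.dvd_span_singleton.2 hmem))

/-- **`ρ_Eis` is reducible**: the coordinate hyperplane `{x | x 1 = 0}` is a proper non-zero
subrepresentation. [folklore] -/
theorem rhoEis_not_isIrreducible : ¬ FramedRep.IsIrreducible (rhoEis p) := by
  classical
  intro hirr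
  set ρ := FramedRep.toRepresentation (rhoEis p) with hρ
  have hact : ∀ (g : absoluteGaloisGroup ℚ) (x : Fin 3 → PadicAlgCl p) (i : Fin 3),
      ρ g x i = diagEntries ![epsPow p 0, epsPow p (-1), epsPow p (-2)] g i * x i := by
    intro g x i
    rw [hρ, FramedRep.toRepresentation_apply_apply, rhoEis, diagRep_apply_coe, Matrix.mulVec_diagonal]
  let L : Subrepresentation ρ :=
    { toSubmodule := LinearMap.ker (LinearMap.proj 1 : (Fin 3 → PadicAlgCl p) →ₗ[PadicAlgCl p] PadicAlgCl p)
      apply_mem_toSubmodule := fun g x hx => by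
        simp only [LinearMap.mem_ker, LinearMap.proj_apply] at hx ⊢
        rw [hact, hx, mul_zero] }
  have hmem : ∀ x : Fin 3 → PadicAlgCl p, x ∈ L.toSubmodule ↔ x 1 = 0 := fun x => by simp [L]
  rcases hirr.eq_bot_or_eq_top L with h | h
  · have h0 : (Pi.single (0 : Fin 3) (1 : PadicAlgCl p) : Fin 3 → PadicAlgCl p) ∈ L.toSubmodule :=
      (hmem _).2 (by simp)
    rw [h] at h0
    change (Pi.single (0 : Fin 3) (1 : PadicAlgCl p) : Fin 3 → PadicAlgCl p) ∈
      (⊥ : Submodule (PadicAlgCl p) (Fin 3 → PadicAlgCl p)) at h0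
    rw [Submodule.mem_bot] at h0
    have h00 := congrFun h0 0
    simp only [Pi.single_eq_same, Pi.zero_apply] at h00
    exact one_ne_zero h00
  · have h1 : (Pi.single (1 : Fin 3) (1 : PadicAlgCl p) : Fin 3 → PadicAlgCl p) ∈ L.toSubmodule := by
      rw [h]
      change (Pi.single (1 : Fin 3) (1 : PadicAlgCl p) : Fin 3 → PadicAlgCl p) ∈
        (⊤ : Submodule (PadicAlgCl p) (Fin 3 → PadicAlgCl p))
      exact Submodule.mem_top
    rw [hmem] at h1
    simp only [Pi.single_eq_same] at h1
    exact one_ne_zero h1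

variable (p)

/-- **The seed hypotheses of `AdjointLiftingGL3` admit an Eisenstein (reducible) `ρ`.**  There are
`ρ : Γ_ℚ →ₜ* GL₃(ℚ̄_p)`, an ODD `ρ₀ : Γ_ℚ →ₜ* GL₂(ℚ̄_p)` and `η` satisfying the crux's seed
congruence `‖tr ρ - η (tr ρ₀²/det ρ₀ - 1)‖ < 1` for all `σ` and the crux's "unramified a.e."
hypothesis, with `ρ` REDUCIBLE (`ρ = 1 ⊕ ε⁻¹ ⊕ ε⁻²`, `ρ₀ = 1 ⊕ ε⁻¹`, `η = ε⁻¹`).  So the seed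
does not carry (residual) irreducibility of `ρ`, of `ρ̄₀` or of `ad⁰ρ̄₀`: any proof of the crux
must use `IsResiduallyAbsIrreducible` to get there. [folklore] -/
theorem seedHypotheses_admit_eisenstein :
    ∃ (ρ : FramedGaloisRep ℚ (PadicAlgCl p) 3) (ρ₀ : FramedGaloisRep ℚ (PadicAlgCl p) 2)
      (η : FramedGaloisRep ℚ (PadicAlgCl p) 1),
      ρ₀.IsOdd ∧
      (∀ σ, ‖(ρ σ).val.trace - (η σ).val 0 0 * ((ρ₀ σ).val.trace ^ 2 * ((ρ₀ σ).val.det)⁻¹ - 1)‖ < 1) ∧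
      (∀ᶠ v : HeightOneSpectrum (𝓞 ℚ) in cofinite, ρ.IsUnramifiedAt v) ∧
      ¬ FramedRep.IsIrreducible ρ :=
  ⟨rhoEis p, rho0 p, eta p, rho0_isOdd, seed_norm_lt_one, rhoEis_unramified_ae,
    rhoEis_not_isIrreducible⟩

/-! ### `AdjointLiftingGL3` without residual irreducibility is false (two printed inputs inline) -/

variable {p}

/-- **`AdjointLiftingGL3` with the hypothesis `IsResiduallyAbsIrreducible` deleted is false**
(the weakened crux is written INLINE: the route decl verbatim with the conjunct
`(ρ.restrictField (CyclotomicField p ℚ)).IsResiduallyAbsIrreducible →` removed), given, at one prime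
`p ≥ 11`, the two printed facts about the Eisenstein witness `ρ_Eis = 1 ⊕ ε⁻¹ ⊕ ε⁻²`:
`H₁` — the pinned Fontaine datum declares `ρ_Eis` crystalline at `p` with labelled Hodge–Tate weights
`{0,1,2}` (Fontaine: `ℚ_p(m)` crystalline, `HT(ε^m) = {-m}`, `D_cris` additive); `H₂` — no
`L`-algebraic cuspidal `π` of `GL₃(𝔸_ℚ)` is Satake–Frobenius compatible almost everywhere with
`ρ_Eis` (Jacquet–Shalika (5.1.3): the match would force Satake parameters `{1, q, q²}`).  Proof: the
Eisenstein triple meets every remaining hypothesis (`rhoEis_unramified_ae`, `H₁`, `rho0_isOdd`,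
`seed_norm_lt_one`), `ι : ℚ̄_p ≃ ℂ` exists (`PadicAlgCl.nonempty_ringEquiv_complex`) and `hcpt`
holds (`isCompact_glFiniteIntegralLevel_holds`), so the weakened crux yields a `π` forbidden by `H₂`.
[cite: FontaineAsterisque223VIII, §1.3 and §2.3.7]
[cite: JacquetShalikaAJM1981, Cor. (2.5) p. 515 and (5.1.3) p. 554] -/
theorem adjointLiftingGL3_false_without_residualIrreducibility (hp : 11 ≤ p)
    (H₁ : ∀ (v : IsDedekindDomain.HeightOneSpectrum (NumberField.RingOfIntegers ℚ))
      (hv : ((p : ℕ) : NumberField.RingOfIntegers ℚ) ∈ v.asIdeal),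
      let D := Literature.NumberTheory.PAdicHodge.fontainePstAdicCompletion v p hv
      D.IsCrystallineFramed ((rhoEis p).toLocal v) ∧
        (letI := D.algebra; ∀ τ : v.adicCompletion ℚ →ₐ[ℚ_[p]] PadicAlgCl p,
          (rhoEis p).labelledHodgeTateWeightsAt v D.algebra D.𝔅 τ.toRingHom = {0, 1, 2}))
    (H₂ : ∀ (ι : PadicAlgCl p ≃+* ℂ)
      (hcpt : Literature.NumberTheory.Automorphic.isCompact_glFiniteIntegralLevel 3 ℚ)
      (π : Literature.NumberTheory.Automorphic.CuspidalAutomorphicRepData 3 ℚ hcpt),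
      π.1.IsLAlgebraic →
        ¬ ∀ᶠ v : IsDedekindDomain.HeightOneSpectrum (NumberField.RingOfIntegers ℚ) in Filter.cofinite,
          Summit.Langlands.SatakeFrobCompatibleAt ι π.1 (rhoEis p) v) :
    ¬ (∀ (p : ℕ) [Fact p.Prime], 11 ≤ p → ∀ ρ : Literature.NumberTheory.GaloisRepresentations.FramedGaloisRep ℚ (PadicAlgCl p) 3, (∀ᶠ v : IsDedekindDomain.HeightOneSpectrum (NumberField.RingOfIntegers ℚ) in Filter.cofinite, ρ.IsUnramifiedAt v) → (∀ (v : IsDedekindDomain.HeightOneSpectrum (NumberField.RingOfIntegers ℚ)) (hv : ((p : ℕ) : NumberField.RingOfIntegers ℚ) ∈ v.asIdeal), let D := Literature.NumberTheory.PAdicHodge.fontainePstAdicCompletion v p hv; D.IsCrystallineFramed (ρ.toLocal v) ∧ (letI := D.algebra; ∀ τ : v.adicCompletion ℚ →ₐ[ℚ_[p]] PadicAlgCl p, ρ.labelledHodgeTateWeightsAt v D.algebra D.𝔅 τ.toRingHom = {0, 1, 2})) → (∃ (ρ₀ : Literature.NumberTheory.GaloisRepresentations.FramedGaloisRep ℚ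 (PadicAlgCl p) 2) (η : Literature.NumberTheory.GaloisRepresentations.FramedGaloisRep ℚ (PadicAlgCl p) 1), ρ₀.IsOdd ∧ ∀ σ, ‖(ρ σ).val.trace - (η σ).val 0 0 * ((ρ₀ σ).val.trace ^ 2 * ((ρ₀ σ).val.det)⁻¹ - 1)‖ < 1) → ∀ (ι : PadicAlgCl p ≃+* ℂ) (hcpt : Literature.NumberTheory.Automorphic.isCompact_glFiniteIntegralLevel 3 ℚ), ∃ π : Literature.NumberTheory.Automorphic.CuspidalAutomorphicRepData 3 ℚ hcpt, π.1.IsLAlgebraic ∧ ∀ᶠ v : IsDedekindDomain.HeightOneSpectrum (NumberField.RingOfIntegers ℚ) in Filter.cofinite, Summit.Langlands.SatakeFrobCompatibleAt ι π.1 ρ v) := by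
  intro h
  obtain ⟨ι⟩ := PadicAlgCl.nonempty_ringEquiv_complex (p := p)
  have hcpt : isCompact_glFiniteIntegralLevel 3 ℚ := isCompact_glFiniteIntegralLevel_holds 3 ℚ
  obtain ⟨π, hL, hcompat⟩ :=
    h p hp (rhoEis p) rhoEis_unramified_ae H₁ ⟨rho0 p, eta p, rho0_isOdd, seed_norm_lt_one⟩ ι hcpt
  exact H₂ ι hcpt π hL hcompat

end Witness

end Summit.Langlands.Langlands.Theorems.AdjointLiftingGL3.Negative

end
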